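import Mathlib

/-!
# The wave covector of a steady short-wave pattern is slaved to the stream function
(solo soloist, blind mode)

Kernel core of the "canonical phase" remark of the forced-carrier steady two-scale ansatz
(SEIL-F, HOME paper §24.2).  A two-scale WKB pattern riding a steady planar carrier `V` has a
wave covector `k` transported along carrier orbits `ẋ = V x` by the COTANGENT cocycle
`k̇ = -(DV)ᵀ k` (written below in weak form, so that no adjoint / completeness is needed).
Two facts make the phase canonical:

* `pairing_hasDerivAt_zero` / `pairing_conserved` (any real inner-product space): the pairing
  `⟪k t, V (x t)⟫` is conserved along the coupled flow — the covector's component along the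
  velocity is a first integral of the cotangent cocycle.
* `fixed_covector_iff` (pure linear algebra, any real inner-product space): if the monodromy of
  the tangent cocycle over a closed orbit is a SHEAR `M = 1 + ⟪w, ·⟫ u` (unipotent, rank one —
  this is the content of `SoloBlindDeadLine`: determinant one and a fixed velocity vector force
  `(M - 1)² = 0`), then a covector `k` is fixed by the transpose cocycle, `⟪k, M v⟫ = ⟪k, v⟫`
  for all `v`, iff the shear vanishes (`w = 0`, an isochronous orbit) or `k ⊥ u`; for a
  non-isochronous closed streamline `u` is the velocity direction, so the only orbit-periodic
  covectors are those annihilating `V`, i.e. the multiples of `∇ψ` (plus the axial direction in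
  2½D).
* `shear_of_det_one_of_mulVec_eq` + `transposeFixed_iff_dot_eq_zero` (planar case, `2 × 2`
  real matrices, self-contained): a matrix of determinant `1` fixing a nonzero vector `v` IS such
  a shear, `M z = z + (w ⬝ᵥ z) • v`, and if `M ≠ 1` the covectors fixed by `Mᵀ` are exactly those
  with `k ⬝ᵥ v = 0`.
Hence a steady small-scale pattern on a non-isochronous planar carrier must have phase
`Φ(ψ) + k_z z` at leading order (assembled at docstring level; the WKB modelling step is not
formalised).  No fluid-mechanical input is used below beyond the displayed ODEs.
-/

namespace Summit.AnomalousDissipation.AnomalousDissipation.Theorems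

open RealInnerProductSpace

section Cotangent

variable {E : Type*} [NormedAddCommGroup E] [InnerProductSpace ℝ E]

/-- Conservation of the pairing `⟪k, V(x)⟫` along the coupled flow `ẋ = V x`,
`k̇ = -(DV(x))ᵀ k` (the cotangent equation in weak form: `⟪k̇, v⟫ = -⟪k, DV(x) v⟫`). -/
theorem pairing_hasDerivAt_zero {V : E → E} {V' : E → (E →L[ℝ] E)} {x k k' : ℝ → E}
    (hV : ∀ t, HasFDerivAt V (V' (x t)) (x t)) (hx : ∀ t, HasDerivAt x (V (x t)) t)
    (hk : ∀ t, HasDerivAt k (k' t) t) (hcot : ∀ t v, ⟪k' t, v⟫ = -⟪k t, V' (x t) v⟫) (t : ℝ) :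
    HasDerivAt (fun s => ⟪k s, V (x s)⟫) 0 t := by
  have hVx : HasDerivAt (fun s => V (x s)) (V' (x t) (V (x t))) t :=
    (hV t).comp_hasDerivAt t (hx t)
  have h := (hk t).inner ℝ hVx
  have hsum : ⟪k t, V' (x t) (V (x t))⟫ + ⟪k' t, V (x t)⟫ = 0 := by
    rw [hcot t (V (x t))]; ring
  simpa [hsum] using h

/-- Integrated form: the pairing is constant in time. -/
theorem pairing_conserved {V : E → E} {V' : E → (E →L[ℝ] E)} {x k k' : ℝ → E}
    (hV : ∀ t, HasFDerivAt V (V' (x t)) (x t)) (hx : ∀ t, HasDerivAt x (V (x t)) t)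
    (hk : ∀ t, HasDerivAt k (k' t) t) (hcot : ∀ t v, ⟪k' t, v⟫ = -⟪k t, V' (x t) v⟫) (t : ℝ) :
    ⟪k t, V (x t)⟫ = ⟪k 0, V (x 0)⟫ := by
  have hd : ∀ s, HasDerivAt (fun s => ⟪k s, V (x s)⟫) 0 s :=
    pairing_hasDerivAt_zero hV hx hk hcot
  exact is_const_of_deriv_eq_zero (fun s => (hd s).differentiableAt)
    (fun s => (hd s).deriv) t 0

end Cotangent

section Shear

variable {E : Type*} [NormedAddCommGroup E] [InnerProductSpace ℝ E]

/-- Fixed covectors of a shear.  If the tangent monodromy acts as `M v = v + ⟪w, v⟫ u`, then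
`k` is fixed by the transpose action (`⟪k, M v⟫ = ⟪k, v⟫` for every `v`) iff the shear is
trivial (`w = 0`) or `k` annihilates the shear direction `u`. -/
theorem fixed_covector_iff (u w k : E) :
    (∀ v : E, ⟪k, v + ⟪w, v⟫ • u⟫ = ⟪k, v⟫) ↔ (w = 0 ∨ ⟪k, u⟫ = 0) := by
  constructor
  · intro h
    by_cases hw : w = 0
    · exact Or.inl hw
    · right
      have h1 := h w
      rw [inner_add_right, inner_smul_right] at h1
      have h2 : ⟪w, w⟫ * ⟪k, u⟫ = 0 := by linarith
      have hww : ⟪w, w⟫ ≠ 0 := by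
        rw [real_inner_self_eq_norm_sq]
        exact pow_ne_zero 2 (norm_ne_zero_iff.mpr hw)
      exact (mul_eq_zero.mp h2).resolve_left hww
  · intro h v
    rcases h with hw | hk
    · simp [hw]
    · rw [inner_add_right, inner_smul_right, hk]; ring

/-- The non-isochronous case in the form used in the text: a non-trivial shear (`w ≠ 0`) along
the velocity direction `u` fixes exactly the covectors annihilating `u`. -/
theorem fixed_covector_iff_orthogonal {u w k : E} (hw : w ≠ 0) :
    (∀ v : E, ⟪k, v + ⟪w, v⟫ • u⟫ = ⟪k, v⟫) ↔ ⟪k, u⟫ = 0 := by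
  rw [fixed_covector_iff]; exact ⟨fun h => h.resolve_left hw, Or.inr⟩

end Shear

section Planar

open Matrix

/-- Planar monodromy with determinant one fixing a nonzero vector `v` is a shear along `v`:
`M z = z + (w ⬝ᵥ z) • v` for some covector `w` (so `M - 1` has range in the line of `v`;
compare `SoloBlindDeadLine.unipotent_of_det_one_of_mulVec_eq`, which gives `(M - 1)² = 0`). -/
theorem shear_of_det_one_of_mulVec_eq (M : Matrix (Fin 2) (Fin 2) ℝ) (v : Fin 2 → ℝ)
    (hdet : M.det = 1) (hv : M *ᵥ v = v) (hv0 : v ≠ 0) :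
    ∃ w : Fin 2 → ℝ, ∀ z : Fin 2 → ℝ, M *ᵥ z = z + (w ⬝ᵥ z) • v := by
  have h0 : M 0 0 * v 0 + M 0 1 * v 1 = v 0 := by
    have := congrFun hv 0; simpa [Matrix.mulVec, dotProduct, Fin.sum_univ_two] using this
  have h1 : M 1 0 * v 0 + M 1 1 * v 1 = v 1 := by
    have := congrFun hv 1; simpa [Matrix.mulVec, dotProduct, Fin.sum_univ_two] using this
  have hker : (M - 1) *ᵥ v = 0 := by
    rw [Matrix.sub_mulVec, hv, Matrix.one_mulVec, sub_self]
  have hdet0 : (M - 1).det = 0 := (Matrix.exists_mulVec_eq_zero_iff).mp ⟨v, hv0, hker⟩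
  rw [Matrix.det_fin_two] at hdet hdet0
  simp only [Matrix.sub_apply, Matrix.one_apply_eq, Matrix.one_apply_ne (by decide : (0 : Fin 2) ≠ 1),
    Matrix.one_apply_ne (by decide : (1 : Fin 2) ≠ 0)] at hdet0
  have htr : M 0 0 + M 1 1 = 2 := by linear_combination hdet - hdet0
  by_cases hp : v 0 = 0
  · have hq : v 1 ≠ 0 := by
      intro h; apply hv0; ext i; fin_cases i <;> simp [hp, h]
    have hb : M 0 1 = 0 := by
      have : M 0 1 * v 1 = 0 := by rw [hp] at h0; linarith [h0]
      exact (mul_eq_zero.mp this).resolve_right hq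
    have hd : M 1 1 = 1 := by
      have : (M 1 1 - 1) * v 1 = 0 := by rw [hp] at h1; linarith [h1]
      have := (mul_eq_zero.mp this).resolve_right hq; linarith
    have ha : M 0 0 = 1 := by linarith
    refine ⟨![M 1 0 / v 1, 0], fun z => ?_⟩
    ext i; fin_cases i
    · simp [Matrix.mulVec, dotProduct, Fin.sum_univ_two, hp, ha, hb]
    · simp [Matrix.mulVec, dotProduct, Fin.sum_univ_two, hd]
      field_simp
      ring
  · refine ⟨![(M 0 0 - 1) / v 0, M 0 1 / v 0], fun z => ?_⟩
    have e1 : v 0 * M 1 0 = v 1 * (M 0 0 - 1) := by linear_combination h1 - v 1 * htr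
    have e2 : v 0 * (M 1 1 - 1) = v 1 * M 0 1 := by linear_combination -h0 + v 0 * htr
    ext i; fin_cases i
    · simp [Matrix.mulVec, dotProduct, Fin.sum_univ_two]
      field_simp
      ring
    · simp [Matrix.mulVec, dotProduct, Fin.sum_univ_two]
      field_simp
      linear_combination z 0 * e1 + z 1 * e2

/-- Fixed covectors of a shear, dot-product form (any finite index type): `k` is fixed by the
transpose of `z ↦ z + (w ⬝ᵥ z) • v` iff `w = 0` or `k ⬝ᵥ v = 0`. -/
theorem dot_shear_fixed_iff {n : Type*} [Fintype n] (v w k : n → ℝ) :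
    (∀ z : n → ℝ, k ⬝ᵥ (z + (w ⬝ᵥ z) • v) = k ⬝ᵥ z) ↔ (w = 0 ∨ k ⬝ᵥ v = 0) := by
  constructor
  · intro h
    by_cases hw : w = 0
    · exact Or.inl hw
    · right
      have h1 := h w
      rw [dotProduct_add, dotProduct_smul, smul_eq_mul] at h1
      have h2 : (w ⬝ᵥ w) * (k ⬝ᵥ v) = 0 := by linarith
      have hww : w ⬝ᵥ w ≠ 0 := fun h0 => hw (dotProduct_self_eq_zero.mp h0)
      exact (mul_eq_zero.mp h2).resolve_left hww
  · intro h z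
    rcases h with hw | hk
    · simp [hw]
    · rw [dotProduct_add, dotProduct_smul, smul_eq_mul, hk]; ring

/-- ASSEMBLED PLANAR STATEMENT.  If the (area-preserving) monodromy `M` of a closed streamline
fixes the velocity vector `v ≠ 0` and is not the identity (non-isochronous orbit), then the
covectors fixed by the transpose cocycle — the admissible wave covectors of a steady short-wave
pattern — are exactly those annihilating the velocity: `k ⬝ᵥ v = 0`, i.e. `k ∥ ∇ψ`. -/
theorem transposeFixed_iff_dot_eq_zero (M : Matrix (Fin 2) (Fin 2) ℝ) (v k : Fin 2 → ℝ)
    (hdet : M.det = 1) (hv : M *ᵥ v = v) (hv0 : v ≠ 0) (hM : M ≠ 1) :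
    (∀ z : Fin 2 → ℝ, k ⬝ᵥ (M *ᵥ z) = k ⬝ᵥ z) ↔ k ⬝ᵥ v = 0 := by
  obtain ⟨w, hw⟩ := shear_of_det_one_of_mulVec_eq M v hdet hv hv0
  have hw0 : w ≠ 0 := by
    intro h
    apply hM
    ext i j
    have := congrFun (hw (Pi.single j 1)) i
    simp [h] at this
    simpa [Matrix.mulVec, dotProduct, Pi.single_apply, Matrix.one_apply, Fin.sum_univ_two,
      eq_comm] using this
  simp_rw [hw]
  rw [dot_shear_fixed_iff]
  exact ⟨fun h => h.resolve_left hw0, Or.inr⟩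

end Planar

end Summit.AnomalousDissipation.AnomalousDissipation.Theorems
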